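import Summits.Ventures.PercRepro.GenQFlatLatticeL
import Summits.Ventures.PercRepro.GenQHyperplaneRowsB
import Summits.Ventures.PercRepro.GenQFlatLatticeS

/-!
# PercRepro — the flat-lattice counting rows, part T: (G-B) at `q = 8` in the certificate vocabulary (night-4, gen 20)

`gb_row_eight`: the `q = 8` twin of part S's `gb_row_seven` (part R's `gb_row_six`) — the `j`-subsets of the rank-`7`
hyperplane traces (`2 ≤ j`, simple `M`) are of rank `7` or lie in a line / plane / solid / rank-`5` flat / rank-`6` flat,
through which at most `C(n − s, 5)` / `C(n − s, 4)` / `C(n − s, 3)` / `C(n − s, 2)` / `C(n − s, 1)` hyperplanes with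
spanning traces pass — exactly the LP's row (G-B) at `q = 8` with the ambient counts `Nl`, `NR 3`, `N4`, `NR 5`, `NR 6`
(the type layer of the `(10, 8)` row: the rank-`8` flats of the core, hyperplanes of rank `7`). Also `flats_le_five_card_le_twentyone` / `ga_eq_row_eight` (the `(G-A)` equality at `q = 8`, `j ≥ 22`) and `flat_bound_le_six`
(the `P0` row at `q = 8`). Imports `GenQFlatLatticeL` (`ga_eq_row_gen`, `flats_le_four_card_le_ten`), `GenQHyperplaneRowsB`
(`flat_bound_le_five`) and `GenQFlatLatticeS`.
-/
namespace PercRepro.Night4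

open Finset ThmH SixFour GenQ PerFlat Star

variable {α : Type*} [DecidableEq α] {M : Matroid α} [M.Finite]

/-- **(G-B) at `q = 8` in the certificate vocabulary** (`2 ≤ j`, simple `M`). -/
theorem gb_row_eight (hs : Simple M) {G : Finset α} (hG : G ⊆ gr M) {j : ℕ} (hj : 2 ≤ j) :
    ∑ s ∈ Finset.range (G.card + 1), s.choose j * hypTr M G 7 s
      ≤ ∑ s ∈ Finset.range (G.card + 1), spSum M G 7 s j
        + ∑ s ∈ Finset.range (G.card + 1), (G.card - s).choose 5 * (s.choose j * Nl M G s)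
        + ∑ s ∈ Finset.range (G.card + 1), (G.card - s).choose 4 * (s.choose j * NR M G 3 s)
        + ∑ s ∈ Finset.range (G.card + 1), (G.card - s).choose 3 * (s.choose j * N4 M G s)
        + ∑ s ∈ Finset.range (G.card + 1), (G.card - s).choose 2 * (s.choose j * NR M G 5 s)
        + ∑ s ∈ Finset.range (G.card + 1), (G.card - s).choose 1 * (s.choose j * NR M G 6 s) := by
  have h := gb_row (M := M) (q := 8) hG (by norm_num) j
  have e7 : Finset.range (8 - 1) = {0, 1, 2, 3, 4, 5, 6} := by decide
  rw [e7, Finset.sum_insert (by decide), Finset.sum_insert (by decide), Finset.sum_insert (by decide),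
    Finset.sum_insert (by decide), Finset.sum_insert (by decide), Finset.sum_insert (by decide),
    Finset.sum_singleton] at h
  simp only [Nat.reduceSub] at h
  refine h.trans ?_
  have h0 : ∀ ρ, ρ ≤ 1 → ∑ s ∈ Finset.range (G.card + 1),
      (G.card - s).choose (7 - ρ) * (s.choose j * hypTr M G ρ s) = 0 := by
    intro ρ hρ
    refine Finset.sum_eq_zero (fun s _ => ?_)
    rcases Nat.lt_or_ge s 2 with hlt | hge
    · rw [Nat.choose_eq_zero_of_lt (by omega : s < j), zero_mul, mul_zero]
    · rw [hypTr_eq_zero_of_le_one hs G hρ hge, mul_zero, mul_zero]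
  have h2 : ∑ s ∈ Finset.range (G.card + 1), (G.card - s).choose 5 * (s.choose j * hypTr M G 2 s)
      ≤ ∑ s ∈ Finset.range (G.card + 1), (G.card - s).choose 5 * (s.choose j * Nl M G s) :=
    Finset.sum_le_sum (fun s _ => Nat.mul_le_mul_left _ (Nat.mul_le_mul_left _
      ((hypTr_le_NR G 2 s).trans (le_of_eq (NR_two_eq_Nl G s)))))
  have h3 : ∑ s ∈ Finset.range (G.card + 1), (G.card - s).choose 4 * (s.choose j * hypTr M G 3 s)
      ≤ ∑ s ∈ Finset.range (G.card + 1), (G.card - s).choose 4 * (s.choose j * NR M G 3 s) :=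
    Finset.sum_le_sum (fun s _ => Nat.mul_le_mul_left _ (Nat.mul_le_mul_left _ (hypTr_le_NR G 3 s)))
  have h4 : ∑ s ∈ Finset.range (G.card + 1), (G.card - s).choose 3 * (s.choose j * hypTr M G 4 s)
      ≤ ∑ s ∈ Finset.range (G.card + 1), (G.card - s).choose 3 * (s.choose j * N4 M G s) :=
    Finset.sum_le_sum (fun s _ => Nat.mul_le_mul_left _ (Nat.mul_le_mul_left _
      ((hypTr_le_NR G 4 s).trans (le_of_eq (NR_four G s)))))
  have h5 : ∑ s ∈ Finset.range (G.card + 1), (G.card - s).choose 2 * (s.choose j * hypTr M G 5 s)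
      ≤ ∑ s ∈ Finset.range (G.card + 1), (G.card - s).choose 2 * (s.choose j * NR M G 5 s) :=
    Finset.sum_le_sum (fun s _ => Nat.mul_le_mul_left _ (Nat.mul_le_mul_left _ (hypTr_le_NR G 5 s)))
  have h6 : ∑ s ∈ Finset.range (G.card + 1), (G.card - s).choose 1 * (s.choose j * hypTr M G 6 s)
      ≤ ∑ s ∈ Finset.range (G.card + 1), (G.card - s).choose 1 * (s.choose j * NR M G 6 s) :=
    Finset.sum_le_sum (fun s _ => Nat.mul_le_mul_left _ (Nat.mul_le_mul_left _ (hypTr_le_NR G 6 s)))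
  have h00 := h0 0 (by norm_num)
  have h01 := h0 1 (by norm_num)
  simp only [Nat.reduceSub] at h00 h01
  omega

/-- The flats of rank `≤ 5` of the core have `≤ 21` points (simple; lines `≤ 3`, planes `≤ 6`, solids `≤ 10`, rank-`5`
flats `≤ 21`) — the flat-bound bridge of `ga_eq_row_gen` at `q = 8` (`B = 21`). -/
theorem flats_le_five_card_le_twentyone (hs : Simple M) (hline : ∀ L ∈ flatsQ M 2, L.card ≤ 3)
    (hplane : ∀ P ∈ flatsQ M 3, P.card ≤ 6) (hsolid : ∀ F ∈ flatsQ M 4, F.card ≤ 10)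
    (hflat5 : ∀ F ∈ flatsQ M 5, F.card ≤ 21) :
    ∀ a ≤ 8 - 3, ∀ K ∈ flatsQ M a, K.card ≤ 21 := by
  intro a ha K hK
  rcases Nat.lt_or_ge a 5 with h5 | h6
  · have := flats_le_four_card_le_ten hs hline hplane hsolid a (by omega) K hK
    omega
  · have ha5 : a = 5 := by omega
    rw [ha5] at hK
    exact hflat5 _ hK

/-- **(G-A), the equality form at `q = 8`, `j ≥ 22`** (the type layer of the `(10, 8)` row):
`C(n, j) = Σ_m #Pc (n−j) m + Σ_s SP_{s,j} + Σ_s C(s, j)·NR 6 s`. -/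
theorem ga_eq_row_eight (hs : Simple M) (hline : ∀ L ∈ flatsQ M 2, L.card ≤ 3)
    (hplane : ∀ P ∈ flatsQ M 3, P.card ≤ 6) (hsolid : ∀ F ∈ flatsQ M 4, F.card ≤ 10)
    (hflat5 : ∀ F ∈ flatsQ M 5, F.card ≤ 21)
    {G : Finset α} (hG : G ⊆ gr M) (hrG : M.eRk (G : Set α) = ((8 : ℕ) : ℕ∞)) {j : ℕ} (h22 : 22 ≤ j)
    (hj : j ≤ G.card) :
    G.card.choose j = ∑ m ∈ Finset.Icc (mTr M G) 8, (Pc M G 8 (G.card - j) m).card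
      + ∑ s ∈ Finset.range (G.card + 1), spSum M G 7 s j
      + ∑ s ∈ Finset.range (G.card + 1), s.choose j * NR M G 6 s :=
  ga_eq_row_gen (B := 21) (by norm_num) (flats_le_five_card_le_twentyone hs hline hplane hsolid hflat5) hG hrG
    (by omega) hj

/-- The flat bounds of the core below rank `7`: every flat of rank `≤ 6` has `≤ 43` points (the `P0` pencil row of the
hyperplane-trace block at `q = 8`: `hypTr_le_one` with `r = 6`). -/
theorem flat_bound_le_six (hs : Simple M) (hline : ∀ L ∈ flatsQ M 2, L.card ≤ 3)
    (hplane : ∀ P ∈ flatsQ M 3, P.card ≤ 6) (hsolid : ∀ F ∈ flatsQ M 4, F.card ≤ 10)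
    (hflat5 : ∀ F ∈ flatsQ M 5, F.card ≤ 21) (hflat6 : ∀ F ∈ flatsQ M 6, F.card ≤ 43) :
    ∀ a, a ≤ 6 → ∀ K ∈ flatsQ M a, K.card ≤ 43 := by
  intro a ha K hK
  rcases Nat.lt_or_ge a 6 with h5 | h6
  · exact (flat_bound_le_five hs hline hplane hsolid hflat5 a (by omega) K hK).trans (by norm_num)
  · have ha6 : a = 6 := by omega
    rw [ha6] at hK
    exact hflat6 K hK

end PercRepro.Night4
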